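import Summits.ResolutionOfSingularities.ResolutionOfSingularities.Theorems.HomologicalConductorNoZenoGenericFibreStage
import Summits.ResolutionOfSingularities.ResolutionOfSingularities.Theorems.HomologicalConductorNoZenoDim2Exhaustion
import Literature.AlgebraicGeometry.Resolution.PrimeDivisors
import HarnessLib

/-!
# Crux `NoZenoR` (stmt-ResolutionOfSingularities-19943), slot 2, tr.deg-3 half `Cap3`: BRANCH (b) AT tr.deg 3 IS A SURFACE DATUM OVER `k⟮t⟯`

OURS (cell res-hironaka, crux chain W4.4; lead res-L0-w44-lead-1 g9, DESK WORD 39 OBJECT 2-R″).  AI-written, weaker than expert review;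
nothing here is a statement of the manuscript under review (Hironaka 2017).  SUPPORT-level, counted 0.  Def-free, fact-free.

At the binders of `Cap3` (the tr.deg-3 half of `Beta1SharpCapture`, file `…NoZenoBeta1Trdeg3`): `O ∋ k` a valuation ring of the finitely
generated `K/k`, `tr.deg_k K = 3`, the kernel binder `hker` (every dominator of the tower is non-noetherian — in particular `O` itself),
and a residually transcendental `t ∈ O` (branch (b)).  Then:

* `not_isNoetherianRing_of_kernel` — `O` is not noetherian (the kernel binder at `O' := O`); so `O ≠ ⊤`.
* `residuePair_dependent` — ANY two elements of `O` have `k`-algebraically DEPENDENT residues: otherwise `O` is a prime divisor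
  (`tr.deg κ(O) ≥ 2 ≥ tr.deg K − 1`), hence a discrete valuation ring (tree `isDiscreteValuationRing_of_primeDivisor`, Zariski–Samuel VI §14
  Thm 31), hence noetherian.  Valuation form `exists_mvPolynomial_valuation_lt_one`: for all `a, b ∈ O` some non-zero `F ∈ k[X, Y]` has
  `v(F(a, b)) > 0`.
* `zeroDimensional_over_t` — in particular every `x ∈ O` satisfies a non-trivial polynomial relation with `t` modulo `𝔪_O`: the residue
  field `κ(O)` is ALGEBRAIC over `k(t̄)` — «ZERO-DIMENSIONALITY OVER `k⟮t⟯`»; with `residueTrdeg_eq_one_of_branchB` (`F = tr.deg_k κ(O) = 1`)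
  and `trdeg_over_adjoin_le_two` (`tr.deg_{k⟮t⟯} K ≤ 2`, the tree's `CoarseningLU.trdeg_adjoin_simple_le`) this places `Cap3` in the
  setting of the kill test `SurfaceTermination` over the IMPERFECT ground field `k⟮t⟯`: `O` is a zero-dimensional valuation of the
  surface `K/k⟮t⟯`, the `k`-tower `T_m` riding under the `k⟮t⟯`-quadratic sequence of a regular generic-fibre stage
  (`GenericFibreStage.exists_regular_genericFibreStage`) along `O`.

References: O. Zariski, P. Samuel, *Commutative Algebra* II, Ch. VI §14, Thm. 31; S. Abhyankar, Amer. J. Math. 78 (1956).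
-/

noncomputable section

-- single-problem summit: the doubled namespace component `ResolutionOfSingularities` is forced
set_option linter.dupNamespace false

namespace Summit.ResolutionOfSingularities.ResolutionOfSingularities.Theorems.NoZeno.Beta1Trdeg3

open Summit.ResolutionOfSingularities.ResolutionOfSingularities.Theses.HomologicalConductor
open Summit.ResolutionOfSingularities.ResolutionOfSingularities.Theorems.NoZeno.Birth
open Summit.ResolutionOfSingularities.ResolutionOfSingularities.Theorems
open Summit.ResolutionOfSingularities.ResolutionOfSingularities.Theorems.NoZeno
open Literature.AlgebraicGeometry.Resolution
open IsLocalRing Polynomial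
open scoped IntermediateField

variable {k K : Type} [Field k] [Field K] [Algebra k K]

/-! ## The kernel binder at `O` itself -/

/-- The kernel binder of β1 applied to the dominator `O' := O`: **`O` is not noetherian**. [this work] -/
theorem not_isNoetherianRing_of_kernel (O : ValuationSubring K) (A : Subalgebra k K)
    (hk : ∀ c : k, algebraMap k K c ∈ O) (hAO : A.toSubring ≤ O.toSubring)
    (hker : ∀ O' : ValuationSubring K,
      (∀ m : ℕ, ∀ s ∈ tower O A m, s ∈ O' ∧ (s⁻¹ ∈ O' → s⁻¹ ∈ O)) → ¬ IsNoetherianRing ↥O') :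
    ¬ IsNoetherianRing ↥O :=
  hker O fun m s hs => ⟨mem_valuationSubring_of_mem_tower O hk hAO m s hs, id⟩

/-! ## Two residues are always dependent -/

/-- **Residue pairs are dependent.**  For a NON-noetherian valuation ring `O ∋ k` of a finitely generated `K/k` with `tr.deg_k K ≤ 3`, no two
elements of `O` have `k`-algebraically independent residues — else `O` would be a prime divisor, hence a discrete valuation ring
(Zariski–Samuel VI §14 Thm 31). [cite: ZariskiSamuel1960, Ch. VI §14, Thm. 31] -/
theorem residuePair_dependent (O : ValuationSubring K) (hk : ∀ c : k, algebraMap k K c ∈ O)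
    (hfg : (⊤ : IntermediateField k K).FG) (htr : Algebra.trdeg k K ≤ 3) (hO : ¬ IsNoetherianRing ↥O) (y : Fin 2 → ↥O) :
    letI := algebraOfMem k O hk
    ¬ AlgebraicIndependent k fun i => residue O (y i) := by
  letI := algebraOfMem k O hk
  haveI := isScalarTower_algebraOfMem k O hk
  intro hy
  have hOtop : O ≠ ⊤ := by
    rintro rfl
    -- the whole field is noetherian (tree `NoZeno.Negative.isNoetherianRing_valuationSubring_top`, inlined)
    exact hO (isNoetherianRing_of_ringEquiv K (Subring.topEquiv (R := K)).symm)
  have hN : Algebra.trdeg k K ≤ (2 : ℕ) + 1 := by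
    have e : ((2 : ℕ) : Cardinal) + 1 = 3 := by norm_num
    rw [e]; exact htr
  haveI : IsDiscreteValuationRing ↥O := isDiscreteValuationRing_of_primeDivisor O hfg hOtop y hy hN
  exact hO inferInstance

/-- **Valuation form**: for all `a, b ∈ O` some non-zero `F ∈ k[X₀, X₁]` has `v(F(a, b)) > 0` (`O` non-noetherian, `tr.deg_k K ≤ 3`).
[cite: ZariskiSamuel1960, Ch. VI §14, Thm. 31] -/
theorem exists_mvPolynomial_valuation_lt_one (O : ValuationSubring K) (hk : ∀ c : k, algebraMap k K c ∈ O)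
    (hfg : (⊤ : IntermediateField k K).FG) (htr : Algebra.trdeg k K ≤ 3) (hO : ¬ IsNoetherianRing ↥O)
    {a b : K} (ha : a ∈ O) (hb : b ∈ O) :
    ∃ F : MvPolynomial (Fin 2) k, F ≠ 0 ∧ O.valuation (MvPolynomial.aeval ![a, b] F) < 1 := by
  classical
  letI := algebraOfMem k O hk
  haveI := isScalarTower_algebraOfMem k O hk
  let y : Fin 2 → ↥O := ![⟨a, ha⟩, ⟨b, hb⟩]
  have hdep := residuePair_dependent O hk hfg htr hO y
  rw [algebraicIndependent_iff] at hdep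
  push Not at hdep
  obtain ⟨F, hF0, hFne⟩ := hdep
  refine ⟨F, hFne, ?_⟩
  -- `F(a, b) ∈ O` with residue `F(ā, b̄) = 0`
  have hy : (fun i => ((y i : ↥O) : K)) = ![a, b] := by
    ext i; fin_cases i <;> rfl
  have h1 : MvPolynomial.aeval ![a, b] F = ((MvPolynomial.aeval y F : ↥O) : K) := by
    rw [← hy]; exact MvPolynomial.aeval_algebraMap_apply K y F
  have h2 : residue O (MvPolynomial.aeval y F) = 0 := by
    have := MvPolynomial.comp_aeval_apply y (IsScalarTower.toAlgHom k ↥O (ResidueField ↥O)) F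
    simp only [IsScalarTower.coe_toAlgHom', ResidueField.algebraMap_eq] at this
    rw [this]; exact hF0
  rw [h1]
  exact (O.valuation_lt_one_iff _).mp ((residue_eq_zero_iff _).mp h2)

/-! ## Branch (b) at transcendence degree 3 -/

/-- **ZERO-DIMENSIONALITY OVER `k⟮t⟯` (branch (b), `tr.deg_k K ≤ 3`).**  For the datum `(O, A)` of the `ca`-tower with the kernel
binder and ANY `t ∈ O` (in branch (b): the unreachable residually transcendental element), every `x ∈ O` satisfies `v(F(t, x)) > 0` for
some non-zero `F ∈ k[X₀, X₁]` — the residue of `x` is algebraic over `k(t̄)`. [cite: ZariskiSamuel1960, Ch. VI §14, Thm. 31] -/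
theorem zeroDimensional_over_t (O : ValuationSubring K) (A : Subalgebra k K)
    (hk : ∀ c : k, algebraMap k K c ∈ O) (hA : A.FG) (hfr : IsFractionRing ↥A K) (hAO : A.toSubring ≤ O.toSubring)
    (hker : ∀ O' : ValuationSubring K,
      (∀ m : ℕ, ∀ s ∈ tower O A m, s ∈ O' ∧ (s⁻¹ ∈ O' → s⁻¹ ∈ O)) → ¬ IsNoetherianRing ↥O')
    (htr : Algebra.trdeg k K ≤ 3) {t : K} (htO : t ∈ O) :
    ∀ x : K, x ∈ O → ∃ F : MvPolynomial (Fin 2) k, F ≠ 0 ∧ O.valuation (MvPolynomial.aeval ![t, x] F) < 1 := by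
  haveI := hfr
  haveI : Algebra.FiniteType k ↥A := A.fg_iff_finiteType.mp hA
  have hfg : (⊤ : IntermediateField k K).FG := IntermediateField.fg_top_of_isFractionRing_of_finiteType k ↥A K
  intro x hx
  exact exists_mvPolynomial_valuation_lt_one O hk hfg htr (not_isNoetherianRing_of_kernel O A hk hAO hker) htO hx

/-- **`F = 1` on branch (b)**: the residual transcendence degree of `O` over `k` is exactly one — at least one by the residually
transcendental `t`, at most one by `residuePair_dependent`. [cite: ZariskiSamuel1960, Ch. VI §14, Thm. 31] -/
theorem residueTrdeg_eq_one_of_branchB (O : ValuationSubring K) (A : Subalgebra k K)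
    (hk : ∀ c : k, algebraMap k K c ∈ O) (hA : A.FG) (hfr : IsFractionRing ↥A K) (hAO : A.toSubring ≤ O.toSubring)
    (hker : ∀ O' : ValuationSubring K,
      (∀ m : ℕ, ∀ s ∈ tower O A m, s ∈ O' ∧ (s⁻¹ ∈ O' → s⁻¹ ∈ O)) → ¬ IsNoetherianRing ↥O')
    (htr : Algebra.trdeg k K ≤ 3) {t : K} (htO : t ∈ O) (ht : ∀ f : k[X], f ≠ 0 → ¬ O.valuation (aeval t f) < 1) :
    residueTrdeg k O hk = 1 := by
  classical
  haveI := hfr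
  haveI : Algebra.FiniteType k ↥A := A.fg_iff_finiteType.mp hA
  have hfg : (⊤ : IntermediateField k K).FG := IntermediateField.fg_top_of_isFractionRing_of_finiteType k ↥A K
  have hO := not_isNoetherianRing_of_kernel O A hk hAO hker
  letI := algebraOfMem k O hk
  haveI := isScalarTower_algebraOfMem k O hk
  -- finiteness: `F < ℵ₀`
  have hN : Algebra.trdeg k K < Cardinal.aleph0 := lt_of_le_of_lt htr (by exact_mod_cast Cardinal.natCast_lt_aleph0)
  obtain ⟨F, hF⟩ := Cardinal.lt_aleph0.mp (residueTrdeg_lt_aleph0 O hk hN)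
  -- `1 ≤ F`: the residue of `t` is transcendental
  have h1 : 1 ≤ F := by
    have hy := exh_algebraicIndependent_residue O hk htO ht
    have hle := hy.cardinalMk_le_trdeg
    simp only [Cardinal.mk_fintype, Fintype.card_unique, Nat.cast_one] at hle
    have hle' : (1 : Cardinal) ≤ residueTrdeg k O hk := hle
    rw [hF] at hle'
    exact_mod_cast hle'
  -- `F ≤ 1`: two independent residues would make `O` a prime divisor
  have h2 : F ≤ 1 := by
    by_contra hlt
    obtain ⟨y, hy⟩ := exists_algebraicIndependent_residue_of_residueTrdeg_eq O hk F hF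
    have hinj : Function.Injective (Fin.castLE (show 2 ≤ F by omega)) := Fin.castLE_injective _
    exact residuePair_dependent O hk hfg htr hO (y ∘ Fin.castLE (show 2 ≤ F by omega)) (hy.comp _ hinj)
  rw [hF]
  exact_mod_cast le_antisymm h2 h1

/-- **`tr.deg_{k⟮t⟯} K ≤ 2`** on branch (b) of a tr.deg-3 datum: over the enlarged ground field `k⟮t⟯ ⊆ O` the function field is that of a
SURFACE (additivity of transcendence degree; tree `CoarseningLU.trdeg_adjoin_simple_le`). [folklore] -/
theorem trdeg_over_adjoin_le_two (O : ValuationSubring K) (htr : Algebra.trdeg k K ≤ 3) {t : K}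
    (ht : ∀ f : k[X], f ≠ 0 → ¬ O.valuation (aeval t f) < 1) : Algebra.trdeg (↥k⟮t⟯) K ≤ 2 := by
  have hw : Transcendental k t := CoarseningLU.transcendental_of_residuallyTranscendental O ht
  exact CoarseningLU.trdeg_adjoin_simple_le hw (n := 2) (by exact_mod_cast htr)

/-! ## Appendix (2-R″ (i) sharp form): `tr.deg_k k⟮t⟯ = 1`, hence `tr.deg_{k⟮t⟯} K = 2` -/

/-- `tr.deg_k k[t] ≤ 1` for any `t ∈ K` (`k[X] ↠ k[t]`). [folklore] -/
theorem trdeg_algebraAdjoin_singleton_le_one (t : K) : Algebra.trdeg k ↥(Algebra.adjoin k ({t} : Set K)) ≤ 1 := by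
  let f : k[X] →ₐ[k] ↥(Algebra.adjoin k ({t} : Set K)) :=
    (Subalgebra.equivOfEq _ _ (Algebra.adjoin_singleton_eq_range_aeval k t).symm).toAlgHom.comp (aeval t).rangeRestrict
  have hf : Function.Surjective f := by
    intro y
    obtain ⟨p, hp⟩ := (AlgHom.mem_range _).mp ((Algebra.adjoin_singleton_eq_range_aeval k t).le y.2)
    refine ⟨p, Subtype.ext ?_⟩
    simp [f, hp]
  have h := trdeg_le_of_surjective f hf
  rwa [Polynomial.trdeg_of_isDomain] at h

open scoped IntermediateField.algebraAdjoinAdjoin in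
/-- `tr.deg_k k⟮t⟯ ≤ 1` for any `t ∈ K` (`k⟮t⟯` is algebraic over `k[t]`, Mathlib's `algebraAdjoinAdjoin` instances, and additivity).
[folklore] -/
theorem trdeg_adjoin_simple_le_one (t : K) : Algebra.trdeg k ↥k⟮t⟯ ≤ 1 := by
  haveI : FaithfulSMul k ↥(Algebra.adjoin k ({t} : Set K)) :=
    (faithfulSMul_iff_algebraMap_injective k _).mpr (algebraMap k ↥(Algebra.adjoin k ({t} : Set K))).injective
  have hadd := trdeg_add_eq k ↥(Algebra.adjoin k ({t} : Set K)) (A := ↥k⟮t⟯)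
  rw [trdeg_eq_zero (R := ↥(Algebra.adjoin k ({t} : Set K))) (A := ↥k⟮t⟯), add_zero] at hadd
  rw [← hadd]
  exact trdeg_algebraAdjoin_singleton_le_one t

/-- **`tr.deg_{k⟮t⟯} K = 2`** for `tr.deg_k K = 3` and `t` transcendental over `k` — on branch (b) of a tr.deg-3 datum, `K` is the function
field of a SURFACE over the enlarged ground field `k⟮t⟯ ⊆ O` (sharp form of `trdeg_over_adjoin_le_two`). [folklore] -/
theorem trdeg_over_adjoin_eq_two {t : K} (hw : Transcendental k t) (htr : Algebra.trdeg k K = 3) :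
    Algebra.trdeg (↥k⟮t⟯) K = 2 := by
  have hadd := trdeg_add_eq k (↥k⟮t⟯) (A := K)
  have h1 : 1 ≤ Algebra.trdeg k ↥k⟮t⟯ := CoarseningLU.one_le_trdeg_adjoin_simple hw
  have he : Algebra.trdeg k ↥k⟮t⟯ = 1 := le_antisymm (trdeg_adjoin_simple_le_one t) h1
  rw [he, htr] at hadd
  have hfin : Algebra.trdeg (↥k⟮t⟯) K < Cardinal.aleph0 := by
    have : Algebra.trdeg (↥k⟮t⟯) K ≤ 3 := by rw [← hadd]; exact le_add_self
    exact lt_of_le_of_lt this (by exact_mod_cast Cardinal.natCast_lt_aleph0)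
  obtain ⟨b, hb⟩ := Cardinal.lt_aleph0.mp hfin
  rw [hb] at hadd ⊢
  have : 1 + b = 3 := by exact_mod_cast hadd
  have hb2 : b = 2 := by omega
  rw [hb2]; norm_num

/-- Branch (b) form: for the residually transcendental `t ∈ O` of a tr.deg-3 datum, `tr.deg_{k⟮t⟯} K = 2`. [folklore] -/
theorem trdeg_over_adjoin_eq_two_of_branchB (O : ValuationSubring K) (htr : Algebra.trdeg k K = 3) {t : K}
    (ht : ∀ f : k[X], f ≠ 0 → ¬ O.valuation (aeval t f) < 1) : Algebra.trdeg (↥k⟮t⟯) K = 2 :=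
  trdeg_over_adjoin_eq_two (CoarseningLU.transcendental_of_residuallyTranscendental O ht) htr

/-! ## Appendix 2 (2-R″ (iii) UNIVARIATE form over `k⟮t⟯`, the input of the tree's dimension lemmas `…locAtCentre_eq`) -/

open IntermediateField in
/-- From a bivariate relation over `k` to a univariate one over `k⟮t⟯`: for `t` transcendental over `k` and `F ∈ k[X₀, X₁]` non-zero
there is a non-zero `f ∈ k⟮t⟯[X]` with `f(x) = F(x, t)`. -/
theorem exists_polynomial_adjoin_of_mvPolynomial {t : K} (hw : Transcendental k t) (x : K)
    {F : MvPolynomial (Fin 2) k} (hF : F ≠ 0) :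
    ∃ f : (↥k⟮t⟯)[X], f ≠ 0 ∧ aeval x f = MvPolynomial.aeval ![x, t] F := by
  classical
  -- the substitution `X₀ ↦ X`, `X₁ ↦ C gen` into `k⟮t⟯[X]`
  let v : Fin 2 → (↥k⟮t⟯)[X] := ![Polynomial.X, Polynomial.C (AdjoinSimple.gen k t)]
  let Θ : MvPolynomial (Fin 2) k →ₐ[k] (↥k⟮t⟯)[X] := MvPolynomial.aeval v
  -- `ψ : k[Y] → k⟮t⟯`, `Y ↦ gen`, is injective (`t` transcendental)
  let ψ : MvPolynomial (Fin 1) k →ₐ[k] ↥k⟮t⟯ := MvPolynomial.aeval fun _ => AdjoinSimple.gen k t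
  have hgen : Transcendental k (AdjoinSimple.gen k t) := by
    rw [transcendental_iff_injective] at hw ⊢
    intro p q hpq
    apply hw
    have := congrArg (fun z : ↥k⟮t⟯ => (z : K)) hpq
    simpa [AdjoinSimple.algebraMap_gen, aeval_algebraMap_apply] using this
  have hψ : Function.Injective ψ := by
    have h : AlgebraicIndependent k (fun _ : Fin 1 => AdjoinSimple.gen k t) :=
      (algebraicIndependent_unique_type_iff (x := fun _ : Fin 1 => AdjoinSimple.gen k t)).mpr hgen
    exact h
  -- `Θ` factors as `finSuccEquiv` followed by `map ψ`, hence is injective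
  have hΘ : Θ = (Polynomial.mapAlgHom ψ).comp (MvPolynomial.finSuccEquiv k 1).toAlgHom := by
    refine MvPolynomial.algHom_ext fun i => ?_
    refine Fin.cases ?_ (fun j => ?_) i
    · simp [Θ, v, MvPolynomial.finSuccEquiv_X_zero]
    · have hj : j = 0 := Subsingleton.elim _ _
      subst hj
      simp only [Θ, v, AlgHom.comp_apply, MvPolynomial.aeval_X]
      change _ = (Polynomial.mapAlgHom ψ) ((MvPolynomial.finSuccEquiv k 1) (MvPolynomial.X (Fin.succ 0)))
      rw [MvPolynomial.finSuccEquiv_X_succ]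
      simp [ψ]
  have hΘinj : Function.Injective Θ := by
    rw [hΘ]
    exact (Polynomial.map_injective (ψ : MvPolynomial (Fin 1) k →+* ↥k⟮t⟯) hψ).comp
      (MvPolynomial.finSuccEquiv k 1).injective
  refine ⟨Θ F, fun h => hF (hΘinj (by rw [h, map_zero])), ?_⟩
  -- evaluation: `aeval x ∘ Θ = MvPolynomial.aeval ![x, t]`
  have hcomp : ((Polynomial.aeval x).restrictScalars k).comp Θ = MvPolynomial.aeval ![x, t] := by
    refine MvPolynomial.algHom_ext fun i => ?_
    refine Fin.cases ?_ (fun j => ?_) i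
    · simp [Θ, v]
    · have hj : j = 0 := Subsingleton.elim _ _
      subst hj
      simp [Θ, v]
  have := congrArg (fun φ => φ F) hcomp
  simpa using this

open IntermediateField in
/-- **ZERO-DIMENSIONALITY OVER `k⟮t⟯`, univariate form (branch (b), `tr.deg_k K ≤ 3`)**: every `x ∈ O` satisfies `v(f(x)) > 0` for some
non-zero `f ∈ k⟮t⟯[X]` — `O` is a ZERO-DIMENSIONAL valuation ring of the surface `K/k⟮t⟯` (the hypothesis shape `hzd` of the tree's
`ringKrullDim_locAtCentre_eq` lemmas over the ground field `k⟮t⟯`). [cite: ZariskiSamuel1960, Ch. VI §14, Thm. 31] -/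
theorem zeroDimensional_over_adjoin (O : ValuationSubring K) (A : Subalgebra k K)
    (hk : ∀ c : k, algebraMap k K c ∈ O) (hA : A.FG) (hfr : IsFractionRing ↥A K) (hAO : A.toSubring ≤ O.toSubring)
    (hker : ∀ O' : ValuationSubring K,
      (∀ m : ℕ, ∀ s ∈ tower O A m, s ∈ O' ∧ (s⁻¹ ∈ O' → s⁻¹ ∈ O)) → ¬ IsNoetherianRing ↥O')
    (htr : Algebra.trdeg k K ≤ 3) {t : K} (htO : t ∈ O) (ht : ∀ f : k[X], f ≠ 0 → ¬ O.valuation (aeval t f) < 1) :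
    ∀ x : K, x ∈ O → ∃ f : (↥k⟮t⟯)[X], f ≠ 0 ∧ O.valuation (aeval x f) < 1 := by
  haveI := hfr
  haveI : Algebra.FiniteType k ↥A := A.fg_iff_finiteType.mp hA
  have hfg : (⊤ : IntermediateField k K).FG := IntermediateField.fg_top_of_isFractionRing_of_finiteType k ↥A K
  have hw : Transcendental k t := CoarseningLU.transcendental_of_residuallyTranscendental O ht
  intro x hx
  obtain ⟨F, hF0, hFv⟩ :=
    exists_mvPolynomial_valuation_lt_one O hk hfg htr (not_isNoetherianRing_of_kernel O A hk hAO hker) hx htO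
  obtain ⟨f, hf0, hfx⟩ := exists_polynomial_adjoin_of_mvPolynomial hw x hF0
  exact ⟨f, hf0, by rw [hfx]; exact hFv⟩

end Summit.ResolutionOfSingularities.ResolutionOfSingularities.Theorems.NoZeno.Beta1Trdeg3

end
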